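import Summits.KontsevichZagierPeriods.KontsevichZagierPeriods.Theses.RootDecompPureDefect
import Literature.NumberTheory.Transcendental.KZVolumeConjectureProofs

/-!
# Route RootDecompPureDefect (E″) — the positivity calculus, `posCertificate`, and the edge
`ProperCone ⟹ PiConnected` (item 31891 ⟹ item 27509), PROVED BY NAME against the born texts

Landing file prepared by the decomp-kz lens-5 seat (generation 10) for the lander / census seat, answering the
writer's ROUTE-EDIT of 2026-08-30T09:54:30Z (route rev 4, commit 4edc0d58f771; new support item
stmt-KontsevichZagierPeriods-31891 `ProperCone`, born text = the lens definitions `IsPosClass` / `posCone` INLINED;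
critic δ-probe `Iff.rfl`, KERNEL rc 0, 2026-08-30T09:56:59Z).  Proposal shape:
`ledger propose --kind proof --target Summits/KontsevichZagierPeriods/KontsevichZagierPeriods/Theorems/RootDecompPureDefectProperCone.lean
 --supports stmt-KontsevichZagierPeriods-27509` (it also serves 31891: every theorem below is stated over the born
decls `ProperCone`, `PiConnected`, `PolyPiCancellation`, `PhantomPiAlgebraic` of the route file).

Contents (all sorry-free, standard axioms):
* §1 frame and the disc class `ϖ = ⟦piRep⟧`;
* §2 POSITIVE CLASSES: the predicate inlined in the born text of 31891 (one representation, non-negative integrand,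
  positive volume; written out, never a `Prop` definition here) and the NEW simplification `isPosRep_iff_pos : (…) ↔ 0 < evalP c`
  (the tree's Viu-Sos semi-canonical reduction `exists_isCompact_sub_mem_relations_of_value_pos` represents EVERY class
  of positive value by one compact volume representation) — so the natural preordering `T = posCone` is, literally,
  `Σ (class of positive value)·(square)`, and `T·T ⊆ T`;
* §3 `posCertificate` (`0 < v g ⟹ (M+1)·g = 1 + c`, `c` a positive class) — value positivity certified INSIDE the calculus;
* §4 the cone `posCone`, `properCone_iff : ProperCone ↔ (T ∩ −T = 0)` (`Iff.rfl` against the born text) and the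
  value form `properCone_iff_value`;
* §5 necessity `properCone_of_summit : KontsevichZagierPeriods → ProperCone` (the piece is WEAKER-OR-EQUAL; the
  interface models of the lens file show it is not equivalent);
* §6 THE EDGE `piConnected_of_properCone : ProperCone → PiConnected` (item 27509 below item 31891), with
  `sqCancel_of_properCone`, and the two halves `polyPiCancellation_of_properCone` (31137, consumes Lindemann via the
  tree theorem `transcendental_pi_holds`) and `phantomPiAlgebraic_of_properCone` (31138);
* §7 the Γ-facing corollary `sqRoot_torsion_of_properCone`: `ProperCone` decides every square root of positive value
  up to the root itself (`u² = w², v u = v w, 0 < v w ⟹ w·(w − u) = 0`) — on an index-two Das pair (`g² = ϖ²ⁱ` up to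
  `ϖ`-torsion, `v g = πⁱ`) this is the pair's identity up to `ϖ`-torsion, by a three-line universal identity.

Source of the mathematics: HOME/decomp-kz-lens-5/g9/PureDefect.lean §12 (critic CLEARED 2026-08-30T09:50:52Z, A9/B8/C9)
and g10/PureDefect.lean §13.
-/

/-! # `RootDecompPureDefectProperConeP1` — part 1/2 of the mechanical ≤360-line split of `RootDecompPureDefectProperCone.lean`
(split by the decomp-kz census seat for landing; mathematics unchanged). -/

noncomputable section

namespace Summit.KontsevichZagierPeriods.RootDecompPureDefect

open Literature.NumberTheory.Transcendental Literature.NumberTheory.Transcendental.KZ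
open Summit.KontsevichZagierPeriods.KontsevichZagierPeriods.Theses.RootDecompPureDefect
open MeasureTheory Set

/-! ## 1. Frame and the disc class -/

/-- The summit statement is `ker evalP = 0` on `P = FormalRep ⧸ relations` (cited frame:
`KontsevichZagierPeriods_iff`, `kzKernelConjecture_iff_isRational`, `toFormalPeriod_eq_zero_iff`). -/
theorem summit_iff_kernel :
    _root_.KontsevichZagierPeriods ↔ ∀ x : FormalPeriodRing, evalP x = 0 → x = 0 := by
  rw [KontsevichZagierPeriods_iff, ← kzKernelConjecture_iff_isRational]
  constructor
  · intro h x hx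
    obtain ⟨c, rfl⟩ := toFormalPeriod_surjective x
    exact toFormalPeriod_eq_zero_iff.mpr (h c (by simpa using hx))
  · intro h c hc
    apply toFormalPeriod_eq_zero_iff.mp
    apply h
    rw [evalP_toFormalPeriod]
    exact hc

/-- The disc class `ϖ = ⟦piRep⟧` (written `toFormalPeriod (of piRep)` in the born texts; this `def` is
reducible to it by `rfl`). -/
def piClass : FormalPeriodRing := toFormalPeriod (of piRep)

/-- Auxiliary step `evalP_piClass`. [bookkeeping] -/
theorem evalP_piClass : evalP piClass = Real.pi := by
  rw [piClass, evalP_toFormalPeriod_of, piRep_value]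

/-- Auxiliary step `evalP_piClass_pow`. [bookkeeping] -/
theorem evalP_piClass_pow (k : ℕ) : evalP (piClass ^ k) = Real.pi ^ k := by
  rw [map_pow, evalP_piClass]

/-- Auxiliary step `evalP_piClass_pow_ne_zero`. [bookkeeping] -/
theorem evalP_piClass_pow_ne_zero (k : ℕ) : evalP (piClass ^ k) ≠ 0 := by
  rw [evalP_piClass_pow]; exact pow_ne_zero _ Real.pi_ne_zero

/-- Auxiliary step `evalP_piClass_pow_pos`. [bookkeeping] -/
theorem evalP_piClass_pow_pos (k : ℕ) : 0 < evalP (piClass ^ k) := by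
  rw [evalP_piClass_pow]; exact pow_pos Real.pi_pos k

/-- `m + 1` is a unit of `P` (inverse: the point class of mass `1/(m+1)`, tree lemma
`natCast_add_one_mul_toFormalPeriod_of_unit_constMul_inv`). -/
theorem natCast_succ_isUnit (m : ℕ) : IsUnit ((m : FormalPeriodRing) + 1) := by
  have h : IsAlgebraic ℚ (((m : ℝ) + 1)⁻¹) := by exact_mod_cast (isAlgebraic_nat (m + 1)).inv
  exact IsUnit.of_mul_eq_one _ (natCast_add_one_mul_toFormalPeriod_of_unit_constMul_inv m h)

/-! ## 2. Positive classes -/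

/-- Single-representation surjectivity: every class of `P` is the class of ONE integral representation. -/
theorem exists_rep (x : FormalPeriodRing) : ∃ (N : ℕ) (s : IntegralRep N), toFormalPeriod (of s) = x := by
  obtain ⟨c, rfl⟩ := toFormalPeriod_surjective x
  obtain ⟨n, m, r, r', h⟩ := exists_integralRep_sub_holds c
  obtain ⟨N, R, hR⟩ := r.exists_of_add_of_sub_of_mem_relations r'.neg
  refine ⟨N, R, ?_⟩
  symm
  rw [toFormalPeriod_eq_iff]
  have : c - of R = (c - (of r - of r')) - (of r' + of r'.neg) + (of r + of r'.neg - of R) := by abel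
  rw [this]
  exact relations.add_mem
    (relations.sub_mem h (levelRel_le_relations (of_add_of_neg_mem_levelRel r'))) hR

/-- **POSITIVE CLASSES.**  The predicate inlined in the born text of item 31891 — «`c` is the class of ONE
representation with non-negative integrand on its domain and positive volume»,
`∃ N r, (∀ z ∈ r.domain, 0 ≤ r.integrand z) ∧ 0 < r.value ∧ ⟦r⟧ = c` — is written out wherever it occurs (no
`Prop`-valued definition in a Theorems file); `isPosRep_iff_pos` shows it is just `0 < v c`. -/
theorem pos_of_isPosRep {c : FormalPeriodRing}
    (hc : ∃ (N : ℕ) (r : IntegralRep N), (∀ z ∈ r.domain, 0 ≤ r.integrand z) ∧ 0 < r.value ∧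
      toFormalPeriod (of r) = c) : 0 < evalP c := by
  obtain ⟨N, r, -, hv, rfl⟩ := hc
  rw [evalP_toFormalPeriod_of]; exact hv

/-- **NEW (g10): every class of positive value is a positive class.**  The tree's Viu-Sos semi-canonical reduction
(`exists_isCompact_sub_mem_relations_of_value_pos`) turns any representation of positive value into an equivalent
compact VOLUME representation (integrand `1`). -/
theorem isPosRep_of_pos {c : FormalPeriodRing} (hc : 0 < evalP c) :
    ∃ (N : ℕ) (r : IntegralRep N), (∀ z ∈ r.domain, 0 ≤ r.integrand z) ∧ 0 < r.value ∧
      toFormalPeriod (of r) = c := by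
  obtain ⟨N, s, rfl⟩ := exists_rep c
  rw [evalP_toFormalPeriod_of] at hc
  obtain ⟨K, hKc, hKi, hK1, hsK⟩ := exists_isCompact_sub_mem_relations_of_value_pos s hc
  exact ⟨_, K, fun z hz => by rw [hK1 z hz]; exact zero_le_one, K.value_pos_of_integrand_eq_one hKc hKi hK1,
    (toFormalPeriod_eq_iff.mpr hsK).symm⟩

/-- `(positive class) ↔ 0 < v c`: positivity of a class is a SIGN condition on ONE representation, and it is decided
by the value. -/
theorem isPosRep_iff_pos {c : FormalPeriodRing} :
    (∃ (N : ℕ) (r : IntegralRep N), (∀ z ∈ r.domain, 0 ≤ r.integrand z) ∧ 0 < r.value ∧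
      toFormalPeriod (of r) = c) ↔ 0 < evalP c :=
  ⟨pos_of_isPosRep, isPosRep_of_pos⟩

/-! ## 3. `posCertificate` -/

/-- Volume representations add up: `(M+1)·⟦K⟧` is again the class of a compact volume representation. -/
theorem exists_volumeRep_nsmul {d : ℕ} (K : IntegralRep d) (hc : IsCompact K.domain)
    (hi : (interior K.domain).Nonempty) (h1 : ∀ x ∈ K.domain, K.integrand x = 1) :
    ∀ M : ℕ, ∃ (D : ℕ) (KM : IntegralRep D), IsCompact KM.domain ∧ (interior KM.domain).Nonempty ∧
      (∀ x ∈ KM.domain, KM.integrand x = 1) ∧ (M + 1) • toFormalPeriod (of K) = toFormalPeriod (of KM)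
  | 0 => ⟨d, K, hc, hi, h1, by rw [zero_add, one_nsmul]⟩
  | M + 1 => by
    obtain ⟨D, KM, hMc, hMi, hM1, hM⟩ := exists_volumeRep_nsmul K hc hi h1 M
    obtain ⟨K₁, hK₁c, hK₁i, hK₁1, hE₁⟩ := K.exists_volumeRep_equivalent_of_le hc hi h1 (le_max_left d D)
    obtain ⟨K₂, hK₂c, hK₂i, hK₂1, hE₂⟩ :=
      KM.exists_volumeRep_equivalent_of_le hMc hMi hM1 (le_max_right d D)
    obtain ⟨KM', hc', hi', h1', hrel⟩ :=
      K₂.exists_volumeRep_of_add_sub_of_mem_relations K₁ hK₂c hK₂i hK₂1 hK₁c hK₁1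
    refine ⟨max d D + 1, KM', hc', hi', h1', ?_⟩
    have h3 : toFormalPeriod (of K₂) + toFormalPeriod (of K₁) = toFormalPeriod (of KM') := by
      rw [← map_add, toFormalPeriod_eq_iff]
      exact hrel
    rw [succ_nsmul, hM, hE₁.toFormalPeriod_eq, hE₂.toFormalPeriod_eq, h3]

/-- **`posCertificate` (THEOREM — value positivity is certified inside the calculus).**  If `0 < v g` then
`(M+1)·g = 1 + c` for some `M : ℕ` and some positive class `c`.  Proof: semi-canonical compact volume form `K` of `g`
(Viu-Sos); Archimedes `(M+1)·vol K > 1`; `(M+1)·⟦K⟧ = ⟦K_M⟧`; cut a unit cube out of `K_M`. -/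
theorem posCertificate (g : FormalPeriodRing) (hg : 0 < evalP g) :
    ∃ (M : ℕ) (c : FormalPeriodRing),
      (∃ (N : ℕ) (r : IntegralRep N), (∀ z ∈ r.domain, 0 ≤ r.integrand z) ∧ 0 < r.value ∧
        toFormalPeriod (of r) = c) ∧ ((M : FormalPeriodRing) + 1) * g = 1 + c := by
  obtain ⟨N, s, rfl⟩ := exists_rep g
  rw [evalP_toFormalPeriod_of] at hg
  obtain ⟨K, hKc, hKi, hK1, hsK⟩ := exists_isCompact_sub_mem_relations_of_value_pos s hg
  have hgK : toFormalPeriod (of s) = toFormalPeriod (of K) := toFormalPeriod_eq_iff.mpr hsK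
  have hvol : 0 < K.value := K.value_pos_of_integrand_eq_one hKc hKi hK1
  obtain ⟨M, hM⟩ := exists_nat_gt (1 / K.value)
  obtain ⟨D, KM, hMc, hMi, hM1, hKM⟩ := exists_volumeRep_nsmul K hKc hKi hK1 M
  have hKMv : KM.value = ((M : ℝ) + 1) * K.value := by
    have h := congrArg evalP hKM
    rw [map_nsmul, evalP_toFormalPeriod_of, evalP_toFormalPeriod_of, nsmul_eq_mul] at h
    rw [← h]; push_cast; ring
  have huc : IsCompact (IntegralRep.unit.domain) := by
    rw [IntegralRep.unit_domain]; exact subsingleton_univ.isCompact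
  have hui : (interior IntegralRep.unit.domain).Nonempty := by
    rw [IntegralRep.unit_domain, interior_univ]; exact univ_nonempty
  have hu1 : ∀ x ∈ IntegralRep.unit.domain, IntegralRep.unit.integrand x = 1 := fun _ _ => rfl
  obtain ⟨B, hBc, hBi, hB1, hEB⟩ :=
    IntegralRep.unit.exists_volumeRep_equivalent_of_le huc hui hu1 (Nat.zero_le D)
  have hBv : B.value = 1 := by
    rw [← Equivalent.value_eq_holds hEB, IntegralRep.value_unit]
  have hlt : B.value < KM.value := by
    rw [hBv, hKMv]
    have h1 : 1 < (M : ℝ) * K.value := by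
      have := (div_lt_iff₀ hvol).mp hM
      linarith
    nlinarith
  obtain ⟨K', hK'c, hK'i, hK'1, hrel⟩ :=
    exists_isCompact_of_sub_of_sub_mem_relations KM B hMc.isBounded hBc.isBounded hM1 hB1 hlt
  refine ⟨M, toFormalPeriod (of K'), ⟨D, K', fun z hz => by rw [hK'1 z hz]; exact zero_le_one,
    K'.value_pos_of_integrand_eq_one hK'c hK'i hK'1, rfl⟩, ?_⟩
  have h1B : toFormalPeriod (of B) = 1 := by rw [← hEB.toFormalPeriod_eq, toFormalPeriod_of_unit]
  have h3 : toFormalPeriod (of KM) - toFormalPeriod (of B) = toFormalPeriod (of K') := by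
    rw [← map_sub, toFormalPeriod_eq_iff]; exact hrel
  have h4 : ((M : FormalPeriodRing) + 1) * toFormalPeriod (of s) = (M + 1) • toFormalPeriod (of K) := by
    rw [hgK, nsmul_eq_mul]; push_cast; ring
  rw [h4, hKM, ← h3, h1B, add_sub_cancel]

/-- The value-form certificate (no representation in the conclusion): `0 < v g ⟹ (M+1)·g = 1 + c` with `0 < v c`. -/
theorem posCertificate' (g : FormalPeriodRing) (hg : 0 < evalP g) :
    ∃ (M : ℕ) (c : FormalPeriodRing), 0 < evalP c ∧ ((M : FormalPeriodRing) + 1) * g = 1 + c := by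
  obtain ⟨M, c, hc, h⟩ := posCertificate g hg
  exact ⟨M, c, pos_of_isPosRep hc, h⟩

/-! ## 4. The natural preordering `T = posCone` and the piece `ProperCone` (item 31891) -/

/-- `T ⊆ P`: finite sums of (positive class) × (square) — verbatim the additive closure inlined in the born text. -/
def posCone : AddSubmonoid FormalPeriodRing :=
  AddSubmonoid.closure {y | ∃ c p : FormalPeriodRing,
    (∃ (N : ℕ) (r : IntegralRep N), (∀ z ∈ r.domain, 0 ≤ r.integrand z) ∧ 0 < r.value ∧
      toFormalPeriod (of r) = c) ∧ y = c * (p * p)}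

/-- Auxiliary step `mul_sq_mem_posCone`. [bookkeeping] -/
theorem mul_sq_mem_posCone {c : FormalPeriodRing}
    (hc : ∃ (N : ℕ) (r : IntegralRep N), (∀ z ∈ r.domain, 0 ≤ r.integrand z) ∧ 0 < r.value ∧
      toFormalPeriod (of r) = c) (p : FormalPeriodRing) :
    c * (p * p) ∈ posCone :=
  AddSubmonoid.subset_closure ⟨c, p, hc, rfl⟩

/-- The working generator: `c·p² ∈ T` whenever `0 < v c`. -/
theorem mul_sq_mem_posCone_of_pos {c : FormalPeriodRing} (hc : 0 < evalP c) (p : FormalPeriodRing) :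
    c * (p * p) ∈ posCone :=
  mul_sq_mem_posCone (isPosRep_of_pos hc) p

/-- Auxiliary step `sq_mem_posCone`. [bookkeeping] -/
theorem sq_mem_posCone (p : FormalPeriodRing) : p * p ∈ posCone := by
  simpa using mul_sq_mem_posCone_of_pos (show 0 < evalP 1 by rw [map_one]; exact one_pos) p

/-- Membership in `posCone_of_pos`, unfolded. [bookkeeping] -/
theorem mem_posCone_of_pos {c : FormalPeriodRing} (hc : 0 < evalP c) : c ∈ posCone := by
  simpa using mul_sq_mem_posCone_of_pos hc 1

/-- Auxiliary step `evalP_nonneg_of_mem_posCone`. [bookkeeping] -/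
theorem evalP_nonneg_of_mem_posCone {t : FormalPeriodRing} (ht : t ∈ posCone) : 0 ≤ evalP t := by
  refine AddSubmonoid.closure_induction (fun y hy => ?_) ?_ (fun x y _ _ hx hy => ?_) ht
  · obtain ⟨c, p, hc, rfl⟩ := hy
    rw [map_mul, map_mul]
    exact mul_nonneg (pos_of_isPosRep hc).le (mul_self_nonneg _)
  · rw [map_zero]
  · rw [map_add]; exact add_nonneg hx hy

/-- Generator induction for `T` in VALUE form. -/
theorem posCone_induction {motive : FormalPeriodRing → Prop}
    (gen : ∀ c p : FormalPeriodRing, 0 < evalP c → motive (c * (p * p))) (zero : motive 0)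
    (add : ∀ x y, motive x → motive y → motive (x + y)) {t : FormalPeriodRing} (ht : t ∈ posCone) : motive t := by
  refine AddSubmonoid.closure_induction (fun y hy => ?_) zero (fun x y _ _ hx hy => add x y hx hy) ht
  obtain ⟨c, p, hc, rfl⟩ := hy
  exact gen c p (pos_of_isPosRep hc)

/-- `T` is multiplicatively closed by positive classes: `c·T ⊆ T`. -/
theorem pos_mul_mem_posCone {c t : FormalPeriodRing} (hc : 0 < evalP c) (ht : t ∈ posCone) :
    c * t ∈ posCone := by
  refine AddSubmonoid.closure_induction (fun y hy => ?_) ?_ (fun x y _ _ hx hy => ?_) ht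
  · obtain ⟨c', p, hc', rfl⟩ := hy
    rw [← mul_assoc]
    exact mul_sq_mem_posCone_of_pos (by rw [map_mul]; exact mul_pos hc (pos_of_isPosRep hc')) p
  · rw [mul_zero]; exact posCone.zero_mem
  · rw [mul_add]; exact posCone.add_mem hx hy

/-- `T·T ⊆ T` (so `T` is a preordering: a subsemiring containing the squares). -/
theorem mul_mem_posCone {s t : FormalPeriodRing} (hs : s ∈ posCone) (ht : t ∈ posCone) : s * t ∈ posCone := by
  refine AddSubmonoid.closure_induction (fun y hy => ?_) ?_ (fun x y _ _ hx hy => ?_) hs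
  · obtain ⟨c, p, hc, rfl⟩ := hy
    have h1 : p * p * t ∈ posCone := by
      refine AddSubmonoid.closure_induction (fun y hy => ?_) ?_ (fun x y _ _ hx hy => ?_) ht
      · obtain ⟨c', q, hc', rfl⟩ := hy
        rw [show p * p * (c' * (q * q)) = c' * ((p * q) * (p * q)) by ring]
        exact mul_sq_mem_posCone hc' _
      · rw [mul_zero]; exact posCone.zero_mem
      · rw [mul_add]; exact posCone.add_mem hx hy
    rw [mul_assoc]
    exact pos_mul_mem_posCone (pos_of_isPosRep hc) h1
  · rw [zero_mul]; exact posCone.zero_mem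
  · rw [add_mul]; exact posCone.add_mem hx hy

/-- Auxiliary step `one_mem_posCone`. [bookkeeping] -/
theorem one_mem_posCone : (1 : FormalPeriodRing) ∈ posCone := by simpa using sq_mem_posCone 1

/-- Auxiliary step `neg_one_not_mem_posCone`. [bookkeeping] -/
theorem neg_one_not_mem_posCone : (-1 : FormalPeriodRing) ∉ posCone := by
  intro h
  have := evalP_nonneg_of_mem_posCone h
  rw [map_neg, map_one] at this
  linarith

/-- **Item 31891 is `T ∩ −T = 0`** (`Iff.rfl` against the born text: the lens definitions are inlined there). -/
theorem properCone_iff : ProperCone ↔ ∀ t : FormalPeriodRing, t ∈ posCone → -t ∈ posCone → t = 0 := Iff.rfl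

/-- The value-form cone `{Σ cᵢ·pᵢ² : 0 < v cᵢ}` IS `T` (by `isPosRep_iff_pos`). -/
theorem posCone_eq_value :
    posCone = AddSubmonoid.closure {y | ∃ c p : FormalPeriodRing, 0 < evalP c ∧ y = c * (p * p)} := by
  apply le_antisymm
  · apply AddSubmonoid.closure_mono
    rintro y ⟨c, p, hc, rfl⟩
    exact ⟨c, p, pos_of_isPosRep hc, rfl⟩
  · apply AddSubmonoid.closure_mono
    rintro y ⟨c, p, hc, rfl⟩
    exact ⟨c, p, isPosRep_of_pos hc, rfl⟩

/-- **VALUE FORM of item 31891**: no representation-level data at all — `Σᵢ cᵢ·pᵢ²` with `0 < v cᵢ` on both sides. -/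
theorem properCone_iff_value :
    ProperCone ↔ ∀ t : FormalPeriodRing,
      t ∈ AddSubmonoid.closure {y | ∃ c p : FormalPeriodRing, 0 < evalP c ∧ y = c * (p * p)} →
      -t ∈ AddSubmonoid.closure {y | ∃ c p : FormalPeriodRing, 0 < evalP c ∧ y = c * (p * p)} → t = 0 := by
  rw [properCone_iff, posCone_eq_value]

/-! ## 5. Necessity: `S ⟹ ProperCone` -/

/-- Auxiliary step `eq_zero_of_mem_posCone_of_evalP`. [bookkeeping] -/
theorem eq_zero_of_mem_posCone_of_evalP (h : _root_.KontsevichZagierPeriods) :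
    ∀ t ∈ posCone, evalP t = 0 → t = 0 := by
  rw [summit_iff_kernel] at h
  intro t ht
  refine AddSubmonoid.closure_induction (motive := fun t _ => evalP t = 0 → t = 0)
    (fun y hy => ?_) ?_ (fun x y hx hy ihx ihy => ?_) ht
  · obtain ⟨c, p, hc, rfl⟩ := hy
    intro hy
    rw [map_mul, map_mul] at hy
    have hp : evalP p = 0 := by
      rcases mul_eq_zero.mp hy with h1 | h2
      · exact absurd h1 (pos_of_isPosRep hc).ne'
      · exact mul_self_eq_zero.mp h2
    rw [h p hp, mul_zero, mul_zero]
  · intro; rfl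
  · intro hxy
    rw [map_add] at hxy
    have h1 := evalP_nonneg_of_mem_posCone hx
    have h2 := evalP_nonneg_of_mem_posCone hy
    rw [ihx (by linarith), ihy (by linarith), add_zero]

/-- **`S ⟹ ProperCone`** (item 31891 is WEAKER-OR-EQUAL; not equivalent: lens models `ℝ[X]`, `𝔑`). -/
theorem properCone_of_summit (h : _root_.KontsevichZagierPeriods) : ProperCone := by
  intro t ht hnt
  apply eq_zero_of_mem_posCone_of_evalP h t ht
  have h1 := evalP_nonneg_of_mem_posCone ht
  have h2 := evalP_nonneg_of_mem_posCone hnt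
  rw [map_neg] at h2
  linarith

/-! ## 6. THE EDGE: `ProperCone ⟹ PiConnected` (item 27509), and both its halves -/

end Summit.KontsevichZagierPeriods.RootDecompPureDefect
end
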